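/- Copyright: prover seat `ym-line-cst-p1` (gen 9), route `CoarseStiffnessTail`, crux `CappedCoarseStiffnessL` (stmt-QuantumFields-25301).
Statement-level record; nothing is claimed beyond what the kernel checks below. -/
import Literature.MathematicalPhysics.QuantumFieldTheory.WilsonPlaquetteChessboardJointTail
import Literature.MathematicalPhysics.QuantumFieldTheory.Balaban1983to89.T3FinestHeightTail

/-!
# `Balaban1983to89.T3FinestHeightJointTail` — the JOINT large-field tail of a FAMILY of bare plaquettes of lattice `SU(N)`
# Yang–Mills on Bałaban's tori, uniformly in the volume (all subfamilies, Peierls-multiplicative; the finest height `j = 0`)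

statement-level skeleton of published theorems with citation tags; proofs where landed; nothing here is a claim about
the Yang–Mills mass gap

WHAT.  The companion file `T3FinestHeightTail` transports the host tree's SINGLE-plaquette Peierls–chessboard tail to the
`Setup` Gibbs measures `gibbsMeasure P β` of `SU(N)` (dictionary `toConfig`/`ofConfig` of `TorusReflectionPositivity`,
`β ↦ β/N`): `Gibbs{θ ≤ |U(∂p) − 1|} ≤ δ(β, θ) := 2e^{8P₂(d)}(c^d)⁻¹(√β)^{d(N²−1)}e^{−βθ²/(2N)}`.  This file transports the
JOINT tail of the host tree (`WilsonPlaquetteJointTail.measureReal_forall_plaquettes_mem_le`, all orientations, pigeonhole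
rate `1/P₂(d)`):

* §1 **`gibbsMeasure_real_forall_dist1_ge_le`** — `∃ c = c(N) ∈ (0, 1]` such that for every `P : Params`, `β ≥ 1`, `θ ≥ 0`
  and EVERY finite family `S` of plaquettes of `T^{(0)}`:
  `Gibbs{∀ p ∈ S, θ ≤ |U(∂p) − 1|} ≤ (min δ(β, θ) 1)^{#S/P₂(d)}` — the same per-plaquette factor as the single tail;
* §2 **`gibbsK_real_forall_dist1_ge_le`** — the cell's three-dimensional `SU(2)` families (`d = 3`, `N = 2`, `P₂ = 3`,
  `β_K = (γε_K)⁻¹`, threshold `θ(K) = g_K p(g_K)`, `β_Kθ(K)² = p(g_K)²`): for every finite family `S` of bare plaquettes of run `K`,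
  `Gibbs_K{∀ q ∈ S, θ(K) ≤ |U(∂q) − 1|} ≤ (min (2e^{24}(c³)⁻¹(√β_K)^9 e^{−p(g_K)²/4}) 1)^{#S/3}`.

This is the integrated, all-subfamilies form at the FINEST height of the large-field factor `exp(−¼p(g_k)²)` per large
plaquette of [Balaban1985UV3] (71): a joint Peierls bound whose rate does not depend on the volume (entropy `(9/2)·log β_K`
per plaquette OF THE FAMILY, not of the lattice).  Consumer: the bare face of the uniform large-field count of crux
`CappedCoarseStiffnessL` (route `CoarseStiffnessTail`, `Summits/…/Theorems/CoarseStiffnessTailCappedCoarseStiffnessLBareUniformCount`).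
WHAT THIS IS NOT: block-averaged plaquettes (heights `j ≥ 1`: the renormalisation-group content of (71)); not a continuum statement.

References: [FrohlichIsraelLiebSimon1978] Thm. 4.1; [OsterwalderSeilerAnnPhys1978] §2; [Balaban1985UV3] (7) p.257, (11) p.258,
(71) p.273; L. Gross, CMP 92 (1983) Thm. 3.6 [Gross1983].
-/

noncomputable section

open MeasureTheory Filter Topology
open scoped BigOperators

namespace Literature.MathematicalPhysics.QuantumFieldTheory.Balaban1983to89

namespace T3FinestHeightJointTail

open Literature.MathematicalPhysics.QuantumLattice (fundamentalRep fundamentalRep_apply continuous_fundamentalRep)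
open T4GenFunBounds (gibbsMeasure integral_gibbsMeasure isProbabilityMeasure_gibbsMeasure)
open Missing (measurable_plaqHol)
open T3FinestHeightTail (gibbsMeasure_real_eq_wilsonMeasure_real beta_mul_θBal_sq)
open scoped Matrix.Norms.L2Operator

/-! ## §1 The joint tail on Bałaban's tori `T^{(0)}` for `SU(N)`, uniformly in the volume -/

section SUN

variable {N : ℕ} [NeZero N]

/-- The tree energy `N − Re Tr W` is `N·(1 − reTr W)` (normalised trace of `Setup`). [folklore] -/
private theorem energy_eq (W : Matrix.specialUnitaryGroup (Fin N) ℂ) :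
    (N : ℝ) - (fundamentalRep (Fin N) W).trace.re = (N : ℝ) * (1 - reTr W) := by
  rw [← reTr_mul_card_SU W]; ring

/-- `Re Tr W ≤ N` on `SU(N)`. [folklore] -/
private theorem trace_re_le (W : Matrix.specialUnitaryGroup (Fin N) ℂ) : (fundamentalRep (Fin N) W).trace.re ≤ N := by
  rw [← reTr_mul_card_SU W]
  have := GaugeGroup.reTr_le_one W
  have hN : (0 : ℝ) ≤ N := Nat.cast_nonneg N
  nlinarith

variable (P : Params)

/-- **THE JOINT LARGE-FIELD TAIL OF A FAMILY OF PLAQUETTES OF LATTICE `SU(N)` YANG–MILLS ON BAŁABAN'S TORI, UNIFORMLY IN THE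
VOLUME.**  There is `c = c(N) ∈ (0, 1]` such that for every `P : Params` (any dimension `d = P.d`, any size), every `β ≥ 1`,
every `θ ≥ 0` and EVERY finite family `S` of plaquettes of the finest torus `T^{(0)}`:
`Gibbs{∀ p ∈ S, θ ≤ |U(∂p) − 1|} ≤ (min (2·e^{8P₂(d)}·(c^d)⁻¹·(√β)^{d(N²−1)}·e^{−βθ²/(2N)}) 1)^{#S/P₂(d)}`, `P₂(d) = #{μ < ν}` —
the host tree's joint Peierls–chessboard tail (`WilsonPlaquetteJointTail.measureReal_forall_plaquettes_mem_le`) with the link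
ball `{|u − 1| ≤ β^{−1/2}}` (Haar volume `≥ c·β^{−(N²−1)/2}`) and the comparisons (11) `|U−1|² ≤ 2N(1 − Re tr U)`,
`1 − Re tr U ≤ ½|U−1|²`, carried through the dictionary `gibbsMeasure_real_eq_wilsonMeasure_real`.  NOT PRINTED as a probability
statement; it is the all-subfamilies integrated form, at the finest height, of the per-plaquette factor `exp(−¼p(g)²)` of (71).
[cite: Balaban1985UV3, (11) p.258 and (71) p.273; FrohlichIsraelLiebSimon1978, Thm. 4.1] -/
theorem gibbsMeasure_real_forall_dist1_ge_le :
    ∃ c : ℝ, 0 < c ∧ c ≤ 1 ∧ ∀ (P : Params) (β : ℝ), 1 ≤ β → ∀ (θ : ℝ), 0 ≤ θ → ∀ S : Finset (Plaq P 0),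
      (gibbsMeasure P β).real {U : GaugeField P 0 (Matrix.specialUnitaryGroup (Fin N) ℂ) |
          ∀ p ∈ S, θ ≤ dist1 (GaugeField.plaqHol U p)} ≤
        (min (2 * Real.exp (8 * Fintype.card {q : Fin P.d × Fin P.d // q.1 < q.2}) * (c ^ P.d)⁻¹ *
          Real.sqrt β ^ (P.d * (N ^ 2 - 1)) * Real.exp (-(β * θ ^ 2 / (2 * N)))) 1) ^
          ((S.card : ℝ) / Fintype.card {q : Fin P.d × Fin P.d // q.1 < q.2}) := by
  obtain ⟨c, hc, hc1, hball⟩ := HaarSmallBallClosedSubgroup.haar_ball_ge_specialUnitaryGroup (n := Fin N) one_pos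
  refine ⟨c, hc, hc1, fun P β hβ θ hθ S => ?_⟩
  set ρ := fundamentalRep (Fin N) with hρdef
  have hρc : Continuous ρ := continuous_fundamentalRep (Fin N)
  have hNr : (0 : ℝ) < N := by exact_mod_cast Nat.pos_of_ne_zero (NeZero.ne N)
  have hβ0 : 0 < β := lt_of_lt_of_le one_pos hβ
  have hβN : 0 ≤ β / N := div_nonneg hβ0.le hNr.le
  -- the radius `r = β^{-1/2}` and the link ball
  set r : ℝ := (Real.sqrt β)⁻¹ with hr
  have hsβ : 0 < Real.sqrt β := Real.sqrt_pos.2 hβ0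
  have hr0 : 0 < r := inv_pos.2 hsβ
  have hr1 : r ≤ 1 := by rw [hr]; exact inv_le_one_of_one_le₀ (Real.one_le_sqrt.2 hβ)
  have hr2 : r ^ 2 = β⁻¹ := by rw [hr, inv_pow, Real.sq_sqrt hβ0.le]
  set B : Set (Matrix.specialUnitaryGroup (Fin N) ℂ) := {g | dist1 g ≤ r} with hB
  have hBm : MeasurableSet B := measurableSet_le RegularGaugeGroup.measurable_dist1 measurable_const
  have hvol : c * r ^ (N ^ 2 - 1) ≤ (haarProbability (Matrix.specialUnitaryGroup (Fin N) ℂ)).real B := by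
    have h := hball (haarProbability (Matrix.specialUnitaryGroup (Fin N) ℂ)) r hr0 hr1
    rw [Fintype.card_fin] at h
    have hset : {V : Matrix.specialUnitaryGroup (Fin N) ℂ | ‖(V : Matrix (Fin N) (Fin N) ℂ) - 1‖ ≤ r} = B := by ext V; rfl
    rw [hset] at h
    rw [measureReal_def]
    exact (ENNReal.ofReal_le_iff_le_toReal (measure_ne_top _ _)).1 h
  have hcr : 0 < c * r ^ (N ^ 2 - 1) := mul_pos hc (pow_pos hr0 _)
  have hBpos : 0 < (haarProbability (Matrix.specialUnitaryGroup (Fin N) ℂ)).real B := lt_of_lt_of_le hcr hvol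
  -- four-link energies on the ball: `≤ 8 N r²`
  have hBen : ∀ g₁ g₂ g₃ g₄ : Matrix.specialUnitaryGroup (Fin N) ℂ, g₁ ∈ B → g₂ ∈ B → g₃ ∈ B → g₄ ∈ B →
      (N : ℝ) - (ρ (g₁ * g₂ * g₃⁻¹ * g₄⁻¹)).trace.re ≤ 8 * N * r ^ 2 := by
    intro g₁ g₂ g₃ g₄ h₁ h₂ h₃ h₄
    simp only [hB, Set.mem_setOf_eq] at h₁ h₂ h₃ h₄
    set W := g₁ * g₂ * g₃⁻¹ * g₄⁻¹ with hW
    have hd : dist1 W ≤ 4 * r := by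
      calc dist1 W ≤ dist1 (g₁ * g₂ * g₃⁻¹) + dist1 g₄⁻¹ := GaugeGroup.dist1_mul_le _ _
        _ ≤ dist1 (g₁ * g₂) + dist1 g₃⁻¹ + dist1 g₄⁻¹ := by have := GaugeGroup.dist1_mul_le (g₁ * g₂) g₃⁻¹; linarith
        _ ≤ dist1 g₁ + dist1 g₂ + dist1 g₃⁻¹ + dist1 g₄⁻¹ := by have := GaugeGroup.dist1_mul_le g₁ g₂; linarith
        _ = dist1 g₁ + dist1 g₂ + dist1 g₃ + dist1 g₄ := by rw [GaugeGroup.dist1_inv, GaugeGroup.dist1_inv]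
        _ ≤ 4 * r := by linarith
    have hq := B10Eq5RegularAction.one_sub_reTr_le_specialUnitaryGroup W
    have hd0 : 0 ≤ dist1 W := GaugeGroup.dist1_nonneg W
    rw [energy_eq]
    have hsq : dist1 W ^ 2 ≤ (4 * r) ^ 2 := pow_le_pow_left₀ hd0 hd 2
    nlinarith
  -- the large-field event: energy `≥ θ²/2`
  set E : Set (Matrix.specialUnitaryGroup (Fin N) ℂ) := {g | θ ≤ dist1 g} with hE
  have hEm : MeasurableSet E := measurableSet_le measurable_const RegularGaugeGroup.measurable_dist1
  have hEconj : ∀ g h : Matrix.specialUnitaryGroup (Fin N) ℂ, h * g * h⁻¹ ∈ E ↔ g ∈ E := fun g h => by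
    simp only [hE, Set.mem_setOf_eq, GaugeGroup.dist1_conj]
  have hEinv : ∀ g : Matrix.specialUnitaryGroup (Fin N) ℂ, g⁻¹ ∈ E ↔ g ∈ E := fun g => by
    simp only [hE, Set.mem_setOf_eq, GaugeGroup.dist1_inv]
  have hEen : ∀ g ∈ E, θ ^ 2 / 2 ≤ (N : ℝ) - (ρ g).trace.re := by
    intro g hg
    simp only [hE, Set.mem_setOf_eq] at hg
    rw [energy_eq]
    have h1 := B10Eq71TorusLocal.dist1_sq_le_specialUnitaryGroup g
    have h2 : θ ^ 2 ≤ dist1 g ^ 2 := pow_le_pow_left₀ hθ hg 2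
    linarith
  -- the embedded family in the host tree's plaquette type `Λ × {μ < ν}` (same corner, same orientation)
  set e : Plaq P 0 → QuantumFieldTheory.Plaquette P.d (P.sitesPerDir 0) := fun p => (p.src, ⟨(p.μ, p.ν), p.hμν⟩) with he
  have heinj : Function.Injective e := fun p q h => by
    cases p; cases q
    simp only [he, Prod.mk.injEq, Subtype.mk.injEq] at h
    obtain ⟨h1, h2, h3⟩ := h
    subst h1; subst h2; subst h3; rfl
  -- the host-tree joint bound at `β/N` for the embedded family
  have hmain := WilsonPlaquetteJointTail.measureReal_forall_plaquettes_mem_le (d := P.d) (L := P.sitesPerDir 0) ρ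
    (even_sitesPerDir P 0) hρc trace_re_le hβN hEm hEconj hEinv hEen hBm hBpos hBen (S.image e)
  have hSm : MeasurableSet {U : GaugeField P 0 (Matrix.specialUnitaryGroup (Fin N) ℂ) | ∀ p ∈ S, θ ≤ dist1 (GaugeField.plaqHol U p)} := by
    have : {U : GaugeField P 0 (Matrix.specialUnitaryGroup (Fin N) ℂ) | ∀ p ∈ S, θ ≤ dist1 (GaugeField.plaqHol U p)} =
        ⋂ p ∈ S, {U | θ ≤ dist1 (GaugeField.plaqHol U p)} := by ext U; simp only [Set.mem_setOf_eq, Set.mem_iInter]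
    rw [this]
    exact MeasurableSet.biInter (Set.to_countable _) fun p _ =>
      measurableSet_le measurable_const (RegularGaugeGroup.measurable_dist1.comp (measurable_plaqHol p))
  -- the `ofConfig`-preimage of the joint event is the host tree's joint event of the embedded family (`plaquetteHolonomy_toConfig`)
  have hpre : (ofConfig (P := P) (j := 0)) ⁻¹' {U : GaugeField P 0 (Matrix.specialUnitaryGroup (Fin N) ℂ) |
      ∀ p ∈ S, θ ≤ dist1 (GaugeField.plaqHol U p)} =
      {V : GaugeConfig P.d (P.sitesPerDir 0) (Matrix.specialUnitaryGroup (Fin N) ℂ) |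
        ∀ Q ∈ S.image e, plaquetteHolonomy V Q.1 Q.2.1.1 Q.2.1.2 ∈ E} := by
    ext V
    simp only [Set.mem_preimage, Set.mem_setOf_eq, Finset.forall_mem_image, he, hE]
    refine forall₂_congr fun p _ => ?_
    rw [← plaquetteHolonomy_toConfig (ofConfig V) p, toConfig_ofConfig]
  rw [gibbsMeasure_real_eq_wilsonMeasure_real P (by linarith) hSm, hpre]
  refine hmain.trans ?_
  rw [Finset.card_image_of_injective _ heinj]
  -- arithmetic: `(β/N)(θ²/2) = βθ²/(2N)`, `(β/N)(8Nr²) = 8`, `Haar(B)^d ≥ (c r^{N²-1})^d`: the per-plaquette constant is `≤ δ`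
  have e1 : β / N * (θ ^ 2 / 2) = β * θ ^ 2 / (2 * N) := by field_simp
  have e2 : β / N * (8 * N * r ^ 2) = 8 := by rw [hr2]; field_simp
  rw [e1, e2]
  set X := Real.exp (-(β * θ ^ 2 / (2 * N))) with hX
  have hX0 : 0 < X := Real.exp_pos _
  have hX1 : X ≤ 1 := by
    rw [hX, Real.exp_le_one_iff]
    have : 0 ≤ β * θ ^ 2 / (2 * N) := by positivity
    linarith
  set Y := Real.exp (8 * (Fintype.card {q : Fin P.d × Fin P.d // q.1 < q.2} : ℝ)) with hY
  have hY0 : 0 < Y := Real.exp_pos _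
  have hvol_d : (c * r ^ (N ^ 2 - 1)) ^ P.d ≤ (haarProbability (Matrix.specialUnitaryGroup (Fin N) ℂ)).real B ^ P.d :=
    pow_le_pow_left₀ hcr.le hvol _
  have hinv : ((haarProbability (Matrix.specialUnitaryGroup (Fin N) ℂ)).real B ^ P.d)⁻¹ ≤ ((c * r ^ (N ^ 2 - 1)) ^ P.d)⁻¹ :=
    inv_anti₀ (pow_pos hcr _) hvol_d
  have hrpow : ((c * r ^ (N ^ 2 - 1)) ^ P.d)⁻¹ = (c ^ P.d)⁻¹ * Real.sqrt β ^ (P.d * (N ^ 2 - 1)) := by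
    rw [hr, mul_pow, ← pow_mul, inv_pow, mul_inv, inv_inv, mul_comm (N ^ 2 - 1) P.d]
  have hMle : (1 + X) * X * Y / (haarProbability (Matrix.specialUnitaryGroup (Fin N) ℂ)).real B ^ P.d ≤
      2 * Y * (c ^ P.d)⁻¹ * Real.sqrt β ^ (P.d * (N ^ 2 - 1)) * X := by
    calc (1 + X) * X * Y / (haarProbability (Matrix.specialUnitaryGroup (Fin N) ℂ)).real B ^ P.d
        = (1 + X) * X * Y * ((haarProbability (Matrix.specialUnitaryGroup (Fin N) ℂ)).real B ^ P.d)⁻¹ := by rw [div_eq_mul_inv]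
      _ ≤ 2 * X * Y * ((c * r ^ (N ^ 2 - 1)) ^ P.d)⁻¹ := by
          have h12 : (1 + X) * X * Y ≤ 2 * X * Y := by nlinarith [mul_pos hX0 hY0]
          exact mul_le_mul h12 hinv (inv_nonneg.2 (pow_nonneg hBpos.le _)) (by positivity)
      _ = 2 * Y * (c ^ P.d)⁻¹ * Real.sqrt β ^ (P.d * (N ^ 2 - 1)) * X := by rw [hrpow]; ring
  have hM0 : 0 ≤ (1 + X) * X * Y / (haarProbability (Matrix.specialUnitaryGroup (Fin N) ℂ)).real B ^ P.d := by positivity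
  refine Real.rpow_le_rpow (le_min hM0 zero_le_one) (min_le_min hMle le_rfl) (by positivity) |>.trans (le_of_eq ?_)
  ring_nf

end SUN

/-! ## §2 The cell's three-dimensional `SU(2)` families: the joint bare tail at the threshold `θ(K) = g_K p(g_K)` -/

section T3

open Literature.MathematicalPhysics.QuantumFieldTheory.Balaban1983to89.T3ContinuumYM3Torus
open Literature.MathematicalPhysics.QuantumFieldTheory.Balaban1983to89.T3UnitScaleTilt
open Literature.MathematicalPhysics.QuantumFieldTheory.Balaban1983to89.T3UnitLawDensityEML (ℰp measurableE_ℰp)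

/-- **THE JOINT BARE LARGE-FIELD TAIL OF THE CELL'S FAMILIES** (finest height, all subfamilies): there is an absolute `c ∈ (0, 1]`
such that for the `SU(2)` three-torus families `F`, every `γ > 0`, every profile `(b₀, p₀)` with `p(g_K) ≥ 0`, every cut-off `K`
with `β_K = (γε_K)⁻¹ ≥ 1`, and EVERY finite family `S` of plaquettes of the finest torus `T^{(0)}_K`:
`Gibbs_K{∀ q ∈ S, θ(K) ≤ |U(∂q) − 1|} ≤ (min (2e^{24}(c³)⁻¹·(√β_K)^9·exp(−p(g_K)²/4)) 1)^{#S/3}` — §1 with `d = 3`, `N = 2`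
(`P₂(3) = 3`, `N² − 1 = 3`, `β_Kθ(K)² = p(g_K)²`).  The joint, volume-uniform form at `j = 0` of the factor `exp(−¼p(g_k)²)` per
large plaquette of (71); heights `j ≥ 1` (block-averaged plaquettes) are NOT covered. [cite: Balaban1985UV3, (7) p.257 and (71) p.273] -/
theorem gibbsK_real_forall_dist1_ge_le :
    ∃ c : ℝ, 0 < c ∧ c ≤ 1 ∧ ∀ (F : T3Family) (γ : ℝ), 0 < γ → ∀ (b₀ p₀ : ℝ) (K : ℕ),
      1 ≤ (F.scheme ℰp γ).β K → 0 ≤ B10.pFun b₀ p₀ (Real.sqrt (γ * ((F.L : ℝ)⁻¹) ^ K)) →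
        ∀ S : Finset (Plaq (F.P K) 0),
        (gibbsK F ℰp γ K).real {U | ∀ q ∈ S, θBal F.L γ b₀ p₀ K ≤ dist1 (GaugeField.plaqHol U q)} ≤
          (min (2 * Real.exp 24 * (c ^ 3)⁻¹ * Real.sqrt ((F.scheme ℰp γ).β K) ^ 9 *
              Real.exp (-(B10.pFun b₀ p₀ (Real.sqrt (γ * ((F.L : ℝ)⁻¹) ^ K)) ^ 2 / 4))) 1) ^ ((S.card : ℝ) / 3) := by
  obtain ⟨c, hc, hc1, h⟩ := gibbsMeasure_real_forall_dist1_ge_le (N := 2)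
  refine ⟨c, hc, hc1, fun F γ hγ b₀ p₀ K hβ hp S => ?_⟩
  have hθ : 0 ≤ θBal F.L γ b₀ p₀ K := mul_nonneg (Real.sqrt_nonneg _) hp
  have hS := h (F.P K) ((F.scheme ℰp γ).β K) hβ (θBal F.L γ b₀ p₀ K) hθ S
  have hcard2 : Fintype.card {q : Fin (F.P K).d × Fin (F.P K).d // q.1 < q.2} = 3 := by
    rw [show (F.P K).d = 3 from rfl]; decide
  have hd3 : (F.P K).d = 3 := rfl
  rw [gibbsK_eq]
  refine hS.trans (le_of_eq ?_)
  rw [hcard2, hd3]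
  have hexp : (F.scheme ℰp γ).β K * θBal F.L γ b₀ p₀ K ^ 2 / (2 * (2 : ℕ)) =
      B10.pFun b₀ p₀ (Real.sqrt (γ * ((F.L : ℝ)⁻¹) ^ K)) ^ 2 / 4 := by
    rw [beta_mul_θBal_sq F hγ]; norm_num
  rw [hexp]
  norm_num

end T3

end T3FinestHeightJointTail

end Literature.MathematicalPhysics.QuantumFieldTheory.Balaban1983to89

end
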